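import Mathlib.RingTheory.MvPolynomial.Homogeneous
import Mathlib.Data.Finsupp.Option
import Mathlib.LinearAlgebra.Matrix.Determinant.Basic
import Summits.ValiantsHypothesis.ValiantsHypothesis.Theses.UlrichPadded
import Literature.AlgebraicGeometry.DeterminantalHypersurfaces.KernerVinnikovSaturation
import Literature.NumberTheory.DiophantineGeometry.BertiniHomogenizationProofs

/-!
# Route `UlrichPadded`, support item `PaddedDictionary` (stmt-ValiantsHypothesis-5670)

The Ulrich / padding dictionary between AFFINE determinantal representations of the permanent
and LINEAR matrices with determinant the padded permanent: for `n ≤ m`,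

  `per_n = det A` for an `m × m` matrix `A` of polynomials of total degree `≤ 1` in the `n²`
  variables `x_ij`
  `↔ x₀^(m-n) · per_n = det M` for an `m × m` matrix `M` of linear forms in `x₀, x_ij`

(Beauville 2000, §1; Mignon–Ressayre 2004, §1; the "padded permanent" of Kadish–Landsberg 2014).
Here `x₀ = X none` and `x_ij = X (some (i, j))` in `MvPolynomial (Option (Fin n × Fin n)) ℂ`.

Proof.
* (→) homogenise every entry in degree `1`: `a ↦ a₁ + a₀ · x₀` (written as
  `∑_{k ≤ 1} rename some (homogeneousComponent k a) · x₀^(1-k)`).  The determinant of the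
  homogenised matrix `M` is a form of degree `m`
  (`Literature.AlgebraicGeometry.DeterminantalHypersurfaces.isHomogeneous_det_of_linear`) whose
  dehomogenisation `x₀ ↦ 1` is `det A = per_n`; so is `x₀^(m-n) · per_n`; and a form of given
  degree is determined by its dehomogenisation (`eq_of_isHomogeneous_of_aeval_elim_eq`, the
  coefficient of `x^d` in a form `F` of degree `N` is the coefficient of `x^(d|some)` in `F(1, x)`).
* (←) dehomogenise entrywise (`x₀ ↦ 1` does not raise total degrees,
  `Literature.NumberTheory.DiophantineGeometry.totalDegree_aeval_elim_le`) and use that ring maps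
  commute with determinants (`AlgHom.map_det`).

No definition is introduced: the dehomogenisation is the substitution
`MvPolynomial.aeval (fun o => o.elim 1 X)` of
`Literature/NumberTheory/DiophantineGeometry/BertiniHomogenizationProofs.lean`, written out.
-/

noncomputable section

open MvPolynomial Matrix
open Literature.Computability.AlgebraicComplexity

namespace Summit.ValiantsHypothesis.Theorems

section Dehomogenisation

variable {R : Type*} [CommRing R] {σ : Type*}

/-- Dehomogenising a monomial: `x^d ↦ x^(d|some)` under `x₀ = X none ↦ 1`,
`X (some v) ↦ X v`. [folklore] -/
theorem aeval_elim_monomial (d : Option σ →₀ ℕ) (c : R) :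
    aeval (fun o : Option σ => (o.elim 1 X : MvPolynomial σ R)) (monomial d c) =
      monomial d.some c := by
  rw [aeval_monomial, Finsupp.prod_option_index _ _ (fun _ => pow_zero _) (fun _ _ _ => pow_add _ _ _)]
  simp only [Option.elim_none, one_pow, one_mul, Option.elim_some]
  rw [MvPolynomial.algebraMap_eq, Finsupp.prod, prod_X_pow_eq_monomial, C_mul_monomial, mul_one]

/-- The degree of an exponent vector on `Option σ` splits as the exponent of `none` plus the
degree of its restriction to `σ`. [folklore] -/
theorem degree_eq_apply_none_add_degree_some (d : Option σ →₀ ℕ) :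
    d.degree = d none + d.some.degree := by
  have h := Finsupp.sum_option_index d (fun _ k => k) (fun _ => rfl) (fun _ _ _ => rfl)
  simpa only [Finsupp.sum, Finsupp.degree_apply] using h

/-- Restriction of exponent vectors `d ↦ d|some` is injective in fixed degree. [folklore] -/
theorem eq_of_some_eq_of_degree_eq {b d : Option σ →₀ ℕ} (h : b.some = d.some)
    (hdeg : b.degree = d.degree) : b = d := by
  have hnone : b none = d none := by
    have h1 := degree_eq_apply_none_add_degree_some b
    have h2 := degree_eq_apply_none_add_degree_some d
    rw [h] at h1
    omega
  ext o
  cases o with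
  | none => exact hnone
  | some a => rw [← Finsupp.some_apply, h, Finsupp.some_apply]

/-- **The coefficients of the dehomogenisation of a form are those of the form**: for `F`
homogeneous of degree `N` and `|d| = N`, the coefficient of `x^(d|some)` in `F(x₀ := 1)` is the
coefficient of `x^d` in `F`. [folklore] -/
theorem coeff_some_aeval_elim_of_isHomogeneous {F : MvPolynomial (Option σ) R} {N : ℕ}
    (hF : F.IsHomogeneous N) {d : Option σ →₀ ℕ} (hd : d.degree = N) :
    coeff d.some (aeval (fun o : Option σ => (o.elim 1 X : MvPolynomial σ R)) F) = coeff d F := by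
  classical
  conv_lhs => rw [F.as_sum, map_sum]
  simp only [aeval_elim_monomial, coeff_sum, coeff_monomial]
  rw [Finset.sum_eq_single d]
  · rw [if_pos rfl]
  · intro b hb hne
    rw [if_neg]
    intro h
    have hbN : b.degree = N := by
      by_contra hbN
      exact (mem_support_iff.mp hb) (hF.coeff_eq_zero hbN)
    exact hne (eq_of_some_eq_of_degree_eq h (hbN.trans hd.symm))
  · intro hd'
    rw [if_pos rfl]
    exact notMem_support_iff.mp hd'

/-- **A form is determined by its dehomogenisation**: two forms of the same degree `N` in
`x₀, x` with the same image under `x₀ ↦ 1` are equal. [folklore] -/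
theorem eq_of_isHomogeneous_of_aeval_elim_eq {F G : MvPolynomial (Option σ) R} {N : ℕ}
    (hF : F.IsHomogeneous N) (hG : G.IsHomogeneous N)
    (h : aeval (fun o : Option σ => (o.elim 1 X : MvPolynomial σ R)) F =
      aeval (fun o : Option σ => (o.elim 1 X : MvPolynomial σ R)) G) : F = G := by
  rw [← sub_eq_zero]
  have hFG : (F - G).IsHomogeneous N := hF.sub hG
  have h0 : aeval (fun o : Option σ => (o.elim 1 X : MvPolynomial σ R)) (F - G) = 0 := by
    rw [map_sub, h, sub_self]
  ext d
  rw [coeff_zero]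
  by_cases hd : d.degree = N
  · rw [← coeff_some_aeval_elim_of_isHomogeneous hFG hd, h0, coeff_zero]
  · exact hFG.coeff_eq_zero hd

/-- **Homogenisation in degree `N`** `∑_{k ≤ N} a_k · x₀^(N-k)` (`a_k` the homogeneous
components, moved to the variables `some _`) is a form of degree `N`. [folklore] -/
theorem isHomogeneous_homogenisation (a : MvPolynomial σ R) (N : ℕ) :
    (∑ k ∈ Finset.range (N + 1), rename some (homogeneousComponent k a) *
      (X none : MvPolynomial (Option σ) R) ^ (N - k)).IsHomogeneous N := by
  refine IsHomogeneous.sum _ _ _ fun k hk => ?_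
  rw [Finset.mem_range] at hk
  have h1 : IsHomogeneous (rename some (homogeneousComponent k a) : MvPolynomial (Option σ) R) k :=
    (homogeneousComponent_isHomogeneous k a).rename_isHomogeneous
  have h2 : IsHomogeneous ((X none : MvPolynomial (Option σ) R) ^ (N - k)) (1 * (N - k)) :=
    (isHomogeneous_X R none).pow _
  have := h1.mul h2
  rwa [one_mul, Nat.add_sub_cancel' (by omega)] at this

/-- Dehomogenising (`x₀ ↦ 1`) the homogenisation in any degree `N ≥ deg a` recovers `a`.
[folklore] -/
theorem aeval_elim_homogenisation (a : MvPolynomial σ R) {N : ℕ} (hN : a.totalDegree ≤ N) :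
    aeval (fun o : Option σ => (o.elim 1 X : MvPolynomial σ R))
      (∑ k ∈ Finset.range (N + 1), rename some (homogeneousComponent k a) *
        (X none : MvPolynomial (Option σ) R) ^ (N - k)) = a := by
  rw [map_sum]
  have hk : ∀ k, aeval (fun o : Option σ => (o.elim 1 X : MvPolynomial σ R))
      (rename some (homogeneousComponent k a) * (X none : MvPolynomial (Option σ) R) ^ (N - k)) =
        homogeneousComponent k a := by
    intro k
    rw [map_mul, map_pow, aeval_X, Option.elim, one_pow, mul_one, aeval_rename]
    change aeval X (homogeneousComponent k a) = _
    rw [aeval_X_left, AlgHom.id_apply]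
  simp only [hk]
  rw [← Finset.sum_range_add_sum_Ico _ (show a.totalDegree + 1 ≤ N + 1 by omega),
    sum_homogeneousComponent, add_eq_left]
  refine Finset.sum_eq_zero fun k hk' => ?_
  rw [Finset.mem_Ico] at hk'
  exact homogeneousComponent_eq_zero (σ := σ) (R := R) (n := k) (φ := a) (by omega)

end Dehomogenisation

/-- **The Ulrich / padding dictionary** (route `UlrichPadded`, item `PaddedDictionary`): for
`n ≤ m`, `per_n` has an affine determinantal representation of size `m` iff `x₀^(m-n) · per_n` is
the determinant of an `m × m` matrix of linear forms in `x₀, x` — homogenise entrywise / set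
`x₀ = 1` (Beauville 2000, §1; Mignon–Ressayre 2004, §1; Kadish–Landsberg 2014, padded
polynomials). [folklore] -/
theorem paddedDictionary_proof :
    Summit.ValiantsHypothesis.ValiantsHypothesis.Theses.UlrichPadded.PaddedDictionary := by
  unfold Summit.ValiantsHypothesis.ValiantsHypothesis.Theses.UlrichPadded.PaddedDictionary
  intro n m hnm
  set dh : MvPolynomial (Option (Fin n × Fin n)) ℂ →ₐ[ℂ] MvPolynomial (Fin n × Fin n) ℂ :=
    aeval fun o : Option (Fin n × Fin n) => (o.elim 1 X : MvPolynomial (Fin n × Fin n) ℂ) with hdh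
  -- the padded permanent dehomogenises to the permanent
  have hR : dh (X none ^ (m - n) * rename some (perPoly (Fin n) ℂ)) = perPoly (Fin n) ℂ := by
    rw [map_mul, map_pow, hdh, aeval_X, Option.elim, one_pow, one_mul, aeval_rename]
    change aeval X (perPoly (Fin n) ℂ) = _
    rw [aeval_X_left, AlgHom.id_apply]
  constructor
  · intro h
    obtain ⟨A, hA, hdet⟩ := (hasDetRepr_iff _ _).1 h
    -- homogenise entrywise in degree 1
    let M : Matrix (Fin m) (Fin m) (MvPolynomial (Option (Fin n × Fin n)) ℂ) := fun i j =>
      ∑ k ∈ Finset.range (1 + 1), rename some (homogeneousComponent k (A i j)) *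
        (X none : MvPolynomial (Option (Fin n × Fin n)) ℂ) ^ (1 - k)
    have hM : ∀ i j, (M i j).IsHomogeneous 1 := fun i j => isHomogeneous_homogenisation (A i j) 1
    refine ⟨M, hM, ?_⟩
    have hdetM : M.det.IsHomogeneous m := by
      simpa using
        Literature.AlgebraicGeometry.DeterminantalHypersurfaces.isHomogeneous_det_of_linear hM
    have hG : (X none ^ (m - n) * rename some (perPoly (Fin n) ℂ) :
        MvPolynomial (Option (Fin n × Fin n)) ℂ).IsHomogeneous m := by
      have h1 : ((X none : MvPolynomial (Option (Fin n × Fin n)) ℂ) ^ (m - n)).IsHomogeneous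
          (1 * (m - n)) := (isHomogeneous_X ℂ none).pow _
      have h2 : (rename some (perPoly (Fin n) ℂ) :
          MvPolynomial (Option (Fin n × Fin n)) ℂ).IsHomogeneous n := by
        simpa using (perPoly_isHomogeneous (n := Fin n) (k := ℂ)).rename_isHomogeneous (f := some)
      have := h1.mul h2
      rwa [one_mul, Nat.sub_add_cancel hnm] at this
    refine eq_of_isHomogeneous_of_aeval_elim_eq hdetM hG ?_
    show dh M.det = dh (X none ^ (m - n) * rename some (perPoly (Fin n) ℂ))
    have hL : dh M.det = perPoly (Fin n) ℂ := by
      rw [AlgHom.map_det]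
      have hMA : dh.mapMatrix M = A := by
        ext i j : 1
        rw [AlgHom.mapMatrix_apply, Matrix.map_apply]
        exact aeval_elim_homogenisation (A i j) (hA i j)
      rw [hMA, hdet]
    rw [hL, hR]
  · rintro ⟨M, hM, hdet⟩
    refine (hasDetRepr_iff _ _).2 ⟨dh.mapMatrix M, fun i j => ?_, ?_⟩
    · rw [AlgHom.mapMatrix_apply, Matrix.map_apply]
      exact (Literature.NumberTheory.DiophantineGeometry.totalDegree_aeval_elim_le (M i j)).trans
        (hM i j).totalDegree_le
    · rw [← AlgHom.map_det, hdet, hR]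

end Summit.ValiantsHypothesis.Theorems

end
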